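import Literature.AlgebraicGeometry.ModuliOfAbelianVarieties.Lan2013.Sec72Defs
import Literature.AlgebraicGeometry.ModuliOfAbelianVarieties.Lan2013.Sec543HeckeCuspLabels
import HarnessLib

/-!
# [Lan2013PELCompactifications] §7.2 ∕ §5.4 — the cusp data of the minimal-compactification tower, DE-POSITED over the
# real cusp labels of §5.4 (bridge structure) — ED. 2: the author's errata (2021-03-14) nos. 45, 81, 82 RECORDED (docstring riders;
# the one declaration is byte-identical)

Topic `AlgebraicGeometry/ModuliOfAbelianVarieties/Lan2013`; namespace
`Literature.AlgebraicGeometry.ModuliOfAbelianVarieties.Lan2013.Sec72Defs` (squad TS, TS-t08; «ED. 3 of ★ `Sec72Defs`» in a separate,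
purely additive module so that ★ `Sec72Defs` and its eight ★ importers stay byte-unchanged).  ★ `MinimalCompactificationTower R GA`
(§7.2.3–§7.2.5) POSITS, per level `H`, the cusp labels `Cusp H` (2010 rev. Def. 5.4.2.4), the surjection relation `CuspSurj` (Def.
5.4.2.13), the zero label `zeroCusp`, «`𝒪`-multi-rank zero» `IsMultirankZero` (Def. 5.4.2.7) and the `g`-assignment relation `IsGAssigned`
(Def. 5.4.3.9), over an abstract group `GA` (= `G(𝔸^{∞,□})`) and universe-polymorphically (`Cusp H : Type u`).  The §5.4 carpets ★
`Sec54CuspLabels` (TS-t08), ★ `Sec542GeneralCuspLabels` ∕ ★ `Sec543HeckeCuspLabels` (TM-t01) now provide these notions REALLY: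
`CuspLabelH 𝓛 j red ℋ : Type 1` (Def. 5.4.2.4), `CuspLabelH.HasSurjection` (Def. 5.4.2.13), `CuspLabelH.multirank` ∕ `.IsMultirankZero`
(Def. 5.4.2.7), `Sec543HeckeCuspLabels.IsGAssigned` (Def. 5.4.3.9), over a PEL-type `𝒪`-lattice `𝓛`, rings `Zh = Ẑ^□`, `Af = 𝔸^{∞,□}`
(`j`), an index ring `Rn` (`red : Zh →+* Rn`) and a level `ℋ : LevelH 𝓛 Zh red` — here ALWAYS at `red = RingHom.id Zh` (level structures
over `Ẑ^□` itself, see `CuspModel`).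

This file records the IDENTIFICATION as one structure `MinimalCompactificationTower.CuspModel 𝔇 𝓛 j`: REAL fields only — a
reading of the tower's group `GA` in `G(𝔸^{∞,□}) ⊂ GL(L ⊗ 𝔸^{∞,□}) × (𝔸^{∞,□})ˣ` (`gA`), of its levels as level structures `LevelH` over
`Ẑ^□` itself (`lvl`, index `red = id`; coherence `mem_lvl`: the level subgroup is `H` read in `G(Ẑ^□)`), an equivalence `cuspEquiv` between the
posited `𝔇.Cusp H` and the real `CuspLabelH`, and the four «iff» ∕ «eq» laws transporting `CuspSurj`, `zeroCusp`, `IsMultirankZero`,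
`IsGAssigned` to their real counterparts.  With `(𝔐 : 𝔇.CuspModel 𝓛 j)` in hand, the tower's cusp data are DETERMINED by §5.4 up to
the one named identification; downstream statements (★ `Sec72MinimalCompactifications`, `Sec71…`, `Sec73…`, `Sec64…`) keep their
signatures.  `cuspCoarse` (`[𝖬_H^{Z_H}]`, Def. 5.4.2.6) stays posited on both sides (★ `Sec542GeneralCuspLabels.boundaryModuli` is itself
a LETTER over the index-only Lem. 5.2.7.5 — since its ED. 2 it denotes the CORRECTED `𝖬_H^{Z_H}` of the author's erratum no. 42: the finite
étale quotient by `Γ_{Φ_H}` of `𝖬_H^{Φ_H} = (∐ 𝖬_n^{Z_n}) ∕ H_n`, no longer a «moduli problem with level-`H_h` structures») and is not bridged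
here.  STATEMENTS ONLY (one structure); nothing asserted; no instance, no notation.  HC_CM is proved only modulo the printed citations
until rung 0 closes.

ED. 2 (AUTHOR'S ERRATA, docstring riders only; squad RULING TS-4 (d) ∕ TS-5 (3), errata hand TS-t08): the author's published errata list
(«Arithmetic compactifications of PEL-type Shimura varieties — Errata», K.-W. Lan, dated 2021-03-14, 96 entries; bib key
`Lan2013PELCompactificationsErrata`; squad concordance `lit/lit7/g2/ERRATA-Lan2013-PUP-author-20210314.lit7g2.md`, entries (45), (81), (82) on
its pp. 4–5, read from that transcription, not from memory) touches three items this bridge cites; none changes what the structure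
`CuspModel` types (all AMBER ∕ wording): (45) «In Prop. 5.4.3.8 and Def. 5.4.3.9, "`H' ⊂ H`" should be "`H` and `H'`"» — `gAssigned_iff`
already quantifies over two ARBITRARY levels `H'`, `H` of the tower (no containment), matching Def. 5.4.3.9 as corrected (★
`Sec543HeckeCuspLabels.IsGAssigned` likewise; the as-printed `H' ⊂ H` survives only inside ★ `IsHeckePair`, flagged there in its ED. 3);
(81) «In 4. of Thm. 7.2.4.1, should simply say that `𝖬_H^{Z_H}` is as in Definition 5.4.2.6, without saying that it represents a moduli
problem» — the strata `Z_{[(Φ_H, δ_H)]} ≅ [𝖬_H^{Z_H}]` indexing `cuspEquiv` ∕ `surj_iff` are unaffected (`cuspCoarse` is a posited scheme on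
both sides); (82) «In 5. of Thm. 7.2.4.1, should say instead that `C_{Φ_H,δ_H}` is an abelian scheme torsor over the finite étale cover
`𝖬_H^{Φ_H}` over the algebraic stack `𝖬_H^{Z_H}` over the coarse moduli space `[𝖬_H^{Z_H}]` (which is a scheme)» — the torsor description is
not typed in ★ `Sec72MinimalCompactifications.Lan2013_7241_part5` nor here (scheme-level carrier: ★
`Sec623Sec624BoundaryChartsLevel.LevelHDatum` ED. 3, `cToMPhiH` ∕ `mPhiToMZ` ∕ `AH`).

## References
* [Lan2013PELCompactifications] K.-W. Lan, *Arithmetic compactifications of PEL-type Shimura varieties*, LMS Monographs 36 (2013),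
  Thm. 7.2.4.1 (p. 464; strata by cusp labels), Def. 5.4.2.4 ∕ 5.4.2.7 ∕ 5.4.2.13 (book pp. ≈ 362–364; 2010 rev. pp. 405–408),
  Def. 5.4.3.9 (p. 372; 2010 rev. p. 416), Def. 1.4.1.4 (levels, pp. 80–81).
* [Lan2013PELCompactificationsErrata] K.-W. Lan, *Arithmetic compactifications of PEL-type Shimura varieties — Errata* (author's list dated
  2021-03-14, 6 pp., 96 entries), nos. (45) (p. 4), (81), (82) (p. 5).
-/

noncomputable section

universe u

namespace Literature.AlgebraicGeometry.ModuliOfAbelianVarieties.Lan2013.Sec72Defs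

open Literature.AlgebraicGeometry.ModuliOfAbelianVarieties.Lan2013
open Literature.AlgebraicGeometry.ModuliOfAbelianVarieties.Lan2013.Sec54CuspLabels
open Literature.AlgebraicGeometry.ModuliOfAbelianVarieties.Lan2013.Sec542GeneralCuspLabels
open Literature.AlgebraicGeometry.ModuliOfAbelianVarieties.Lan2013.Sec543HeckeCuspLabels

namespace MinimalCompactificationTower

variable {R : Type u} [CommRing R] {GA : Type u} [Group GA] (𝔇 : MinimalCompactificationTower R GA)
variable {O : Type} [CommRing O] [StarRing O] [Module.Free ℤ O] [Module.Finite ℤ O]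
variable {L : Type} [AddCommGroup L] [Module O L] [Module.Free ℤ L] [Module.Finite ℤ L]
variable {Zh : Type} [CommRing Zh] {Af : Type} [CommRing Af]
variable (𝓛 : PELTypeOLattice O L) (j : Zh →+* Af)

/-- **A §5.4-model of the cusp data of a minimal-compactification tower** (Thm. 7.2.4.1 4: the strata of `𝖬^min_H` are labelled by
the cusp labels `[(Φ_H, δ_H)]` at level `H`, Def. 5.4.2.4; surjections Def. 5.4.2.13; multi-rank Def. 5.4.2.7; `g`-assignment Def.
5.4.3.9): the tower's group `GA` is read inside `GL(L ⊗ 𝔸^{∞,□}) × (𝔸^{∞,□})ˣ` (where `G(𝔸^{∞,□})` = ★ `PELTypeOLattice.G Af` lives),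
each level `H` (`𝔇.IsLevel H`: ANY open compact subgroup of `G(Ẑ^□)`, arbitrarily small) is read as a level structure `LevelH 𝓛 Zh
(RingHom.id Zh)` over `Ẑ^□` ITSELF — the index is HARD-WIRED to `red = id` («`n = ∞`»): no single finite index `n` with `𝒰^□(n) ⊆ H`
serves all levels of a tower (squad QA «QA7-45»), while over `Ẑ^□` the representatives ★ `PCuspRep 𝓛 j (RingHom.id Zh)` are the triples
`(Z, Φ, δ)` themselves (`IsReduction id` and `IsReductionOf id` are identities) and ★ `CuspLabelH 𝓛 j (RingHom.id Zh) ℋ` is their set of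
`H`-orbit classes — print's cusp labels at level `H`, which do not depend on the auxiliary index (Conv. 5.3.1.15; Def. 5.4.2.1 2 «determined
… by reduction mod `n`»; Prop. 5.4.3.8 1–2 works with `H`-orbits of filtrations and torus arguments over `Ẑ^□`) — its subgroup being `H`
read in `G(Ẑ^□)` (`mem_lvl`), and the posited `𝔇.Cusp H` is identified with the real `CuspLabelH 𝓛 j (RingHom.id Zh) (lvl H _)`
compatibly with surjections, the zero label (the unique label of `𝒪`-multi-rank zero), multi-rank zero and `g`-assignment (the
latter on representatives, as ★ `Sec72Defs` words it: «there are representatives … such that `(Φ_H, δ_H)` is `g`-assigned to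
`(Φ_{H'}, δ_{H'})`»).  «Fully symplectic» inside `PCuspRep` is Def. 5.2.7.1 IN FULL (finite-adelic AND archimedean component, ★
`Sec54CuspLabels` ED. 2, squad QA «QA7-44»), so the right-hand side has no phantom labels at data with a compact factor.  deg-check: the
genuine tower (all open compact `H`, `GA = G(𝔸^{∞,□})`, `Cusp H :=` the `H`-orbit classes over `Ẑ^□`) admits the tautological model at
`red = id`; CONSUMERS must keep `red = id` (it is not a parameter).  ERRATA (ED. 2; declaration byte-identical): the author's errata
(2021-03-14) nos. 81–82 reword Thm. 7.2.4.1 4–5 («`𝖬_H^{Z_H}` is as in Definition 5.4.2.6 [as corrected by no. 42], without saying that it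
represents a moduli problem»; «`C_{Φ_H,δ_H}` is an abelian scheme torsor over the finite étale cover `𝖬_H^{Φ_H}` over the algebraic stack
`𝖬_H^{Z_H}` over the coarse moduli space `[𝖬_H^{Z_H}]`») — the labelling of strata by cusp labels, which is all this model reads from part 4,
is unchanged; no. 45 («"`H' ⊂ H`" should be "`H` and `H'`"» in Prop. 5.4.3.8 ∕ Def. 5.4.3.9) is already how `gAssigned_iff` is typed (two
arbitrary levels `H'`, `H`; no containment assumed).
[cite: Lan2013PELCompactifications, Thm. 7.2.4.1 (p. 464), Def. 5.4.2.4 ∕ 5.4.2.7 ∕ 5.4.2.13 (2010 rev. pp. 405–408) and Def. 5.4.3.9 (p. 372; 2010 rev. p. 416); author's errata (2021-03-14) nos. 45, 81, 82]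
[cite: Lan2013PELCompactificationsErrata, nos. 45, 81, 82] -/
structure CuspModel where
  /-- `GA → GL(L ⊗ 𝔸^{∞,□}) × (𝔸^{∞,□})ˣ`, the reading of the tower's group as finite-adelic points -/
  gA : GA →* GL (Fin (rankL L)) Af × Afˣ
  /-- `GA` is (read inside) `G(𝔸^{∞,□})` -/
  gA_mem : ∀ x : GA, gA x ∈ 𝓛.G Af
  /-- each level `H` of the tower as a level structure over `Ẑ^□` itself (index `red = id`, «`n = ∞`»: every open compact
  `H ⊂ G(Ẑ^□)` qualifies, `principal_le` being vacuous) -/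
  lvl : ∀ H : Subgroup GA, 𝔇.IsLevel H → LevelH 𝓛 Zh (RingHom.id Zh)
  /-- the level subgroup IS `H` read in `G(Ẑ^□)`: `x ∈ (lvl H).H ↔ j_*(x) ∈ H` inside `GA` -/
  mem_lvl : ∀ (H : Subgroup GA) (hH : 𝔇.IsLevel H) (x : GL (Fin (rankL L)) Zh × Zhˣ),
    x ∈ (lvl H hH).H ↔ ∃ y ∈ H, gA y = glMap j x
  /-- the posited cusp labels at level `H` ARE the cusp labels at level `H` of Def. 5.4.2.4 -/
  cuspEquiv : ∀ (H : Subgroup GA) (hH : 𝔇.IsLevel H), 𝔇.Cusp H ≃ CuspLabelH 𝓛 j (RingHom.id Zh) (lvl H hH)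
  /-- `CuspSurj` is «there is a surjection» of Def. 5.4.2.13 -/
  surj_iff : ∀ (H : Subgroup GA) (hH : 𝔇.IsLevel H) (c' c : 𝔇.Cusp H),
    𝔇.CuspSurj H c' c ↔ (cuspEquiv H hH c').HasSurjection (cuspEquiv H hH c)
  /-- the zero label `[(0, 0)]` has `𝒪`-multi-rank zero (Def. 5.4.2.7; this pins it: `Z_{-2} = 0` forces `X = Y = 0`) -/
  zeroCusp_multirank : ∀ (H : Subgroup GA) (hH : 𝔇.IsLevel H), (cuspEquiv H hH (𝔇.zeroCusp H)).IsMultirankZero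
  /-- `IsMultirankZero` is «of `𝒪`-multi-rank zero» (Def. 5.4.2.7) -/
  multirankZero_iff : ∀ (H : Subgroup GA) (hH : 𝔇.IsLevel H) (c : 𝔇.Cusp H),
    𝔇.IsMultirankZero H c ↔ (cuspEquiv H hH c).IsMultirankZero
  /-- `IsGAssigned g H' H c' c` is Def. 5.4.3.9 on some representatives (two arbitrary levels `H'`, `H` — «`H` and `H'`», author's
  erratum no. 45; no `H' ⊂ H` assumed) -/
  gAssigned_iff : ∀ (g : GA) (H' H : Subgroup GA) (hH' : 𝔇.IsLevel H') (hH : 𝔇.IsLevel H) (c' : 𝔇.Cusp H') (c : 𝔇.Cusp H),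
    𝔇.IsGAssigned g H' H c' c ↔
      ∃ r' r : PCuspRep 𝓛 j (RingHom.id Zh), Quot.mk _ r' = cuspEquiv H' hH' c' ∧ Quot.mk _ r = cuspEquiv H hH c ∧
        Sec543HeckeCuspLabels.IsGAssigned (gA g) (lvl H' hH') (lvl H hH) r' r

end MinimalCompactificationTower

end Literature.AlgebraicGeometry.ModuliOfAbelianVarieties.Lan2013.Sec72Defs
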